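import Summits.Ventures.CertifiedManyBodySolver.Observables.RungLeavesCoverage
import Summits.Ventures.CertifiedManyBodySolver.Observables.StiffnessApexTransportCurtainTopLaBoxE
import HarnessLib

/-!
# M2(b) closers from the (E6) curtain «station 29/5 + SHORT overhang + LEFT-EDGE TOP» — the «74/5 insurance» edition (`boxLa214E_M2b`,
# «La214-E» `[−3/10, −1/5] × [29/5, 74/5] × n = 1`)

Venture CertifiedManyBodySolver, cell `pub/hubbard-downfold` (MO-S1 ↔ S2 seam; D-0154 (1)(C) COVERAGE, La214 M2(b)/(c) depth, director-hubbard R18: the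
`74/5` pair `(74/5, 1, −3/10 | −1/5)` and the `U = 8` twins are INSURANCE objects); namespace `Summit.Ventures.CertifiedManyBodySolver.Downfold`; seat
`hubbard-cov-la214-unc-2` (`prover-hubbard-cov-la214-unc-2-0`). Companion of `Downfold/BoxesLa214V115M2bCurtain.lean` (seat hubbard-downfold-unc-2 g15: the
(E1)/(E2)/(E3) closers) and of `Observables/StiffnessApexTransportCurtainTop{,LaBoxE}.lean` (this seat: the two-window curtain master and edition (E6)).

WHAT (E6) BUYS. Under (E1) the one station `29/5` needs corner-objective words on the overhang `[−357/740, −3/10]` (`≈ −0.4824`), whose far vertex serves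
only the top-left corner of the box; under (E6) with the window height `U_L = 8` the overhang is `[−153/400, −3/10]` (`−0.3825`) and the top slab
`U ∈ [8, 74/5]` left of the station's reach is served by own words on `{−3/10} × [8, 74/5]` — a `U`-segment family whose two vertices are the insurance
parents `(8, 1, −3/10)` and `(74/5, 1, −3/10)`. ONE-`exact` CLOSERS of the M2(b) stiffness word `HoldsOn (p ↦ ObsStiffnessSeqCeilingAt (p tp) (p U) (p n) c) boxLa214E_M2b`:
* `boxLa214E_M2b_stiffnessWord_of_apexStation29o5_shortOverhang_and_leftEdgeTop` — any window height `U_L ≥ 29/5`, family form;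
* `boxLa214E_M2b_stiffnessWord_of_apexStation29o5_shortOverhang153o400_and_leftEdgeTop8` — `U_L = 8`, family form;
* `boxLa214E_M2b_stiffnessWord_of_apexStation29o5_innerChord_shortOverhangChord153o400_and_leftEdgeTop8Chord` — `U_L = 8`, THREE BUNDLES (inner
  `[−3/10, −1/5] × {29/5}` own words; overhang `[−153/400, −3/10] × {29/5}` objective `−X₀(−3/10)`; left-top `{−3/10} × [8, 74/5]` own words, chord IN `U`),
  six vertex constants, `c ≥` each of the six negated;
and the RUNG-LEAF dischargers `La214M2b_StiffnessBoxCeiling_of_apexStation29o5_shortOverhang_and_leftEdgeTop` /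
`La214M2b_StiffnessBoxCeiling_of_apexStation29o5_leftEdgeTop8_threeBundles` (`c ≤ 0.4364687`).

Everything here is PROVED; no `sorry`, no definition. HONEST FRAMING: one-sided stiffness CEILINGS conditional BY NAME on the bundles plugged in
(CONTROL/CALIBRATION class at Mott points; a ceiling is silent on `ρ_s = 0`); typing certifies nothing about La₂CuO₄; no summit statement is proved
here; no phase sentence; no number of record (the kinematic scale `k(−3/10) = 0.4392` quoted in the companions is [float] planning arithmetic).
-/

noncomputable section

namespace Summit.Ventures.CertifiedManyBodySolver.Downfold

open Set NonemptyInterval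
open Summit.Ventures.CertifiedManyBodySolver.Observables
open Summit.Ventures.CertifiedManyBodySolver.Certificates
open Literature.MathematicalPhysics.QuantumLattice Literature.MathematicalPhysics.QuantumLattice.ThermodynamicLimit
open Literature.Probability.LatticeModels
open Matrix Finset HubbardWave0
open scoped BigOperators ComplexOrder

/-! ## §1 (E6) family form, any window height `U_L ≥ 29/5` -/

/-- **M2(b) CLOSER — (E6), any window height `U_L ≥ 29/5`, family form.** An own-word orbit-lower family `valI` on the inner source segment
`[−3/10, −1/5] × {29/5}`, an orbit-lower family `valO` for the FIXED corner objective `−X₀(−3/10)` on the SHORT overhang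
`[(−3/10)(2 − (29/5)/U_L), −3/10] × {29/5}`, and an own-word orbit-lower family `valL` on the left-edge top `{−3/10} × [U_L, 74/5]` (half filling), all
with `−val ≤ c`, give the stiffness word `c` on `boxLa214E_M2b`. [cite: KomaTasaki1994, §1] [cite: ScalapinoWhiteZhang1993, §II] -/
theorem boxLa214E_M2b_stiffnessWord_of_apexStation29o5_shortOverhang_and_leftEdgeTop (UL : ℝ) (hAL : 29 / 5 ≤ UL)
    (valI valO valL : ℝ → ℝ) (c : ℚ)
    (hI : ∀ s ∈ Set.Icc (-3 / 10 : ℝ) (-1 / 5),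
      ∀ (ω : InfVolFermionState 2) (Ls : ℕ → ℕ) (ψ : ∀ L, Fock (Orb (FermionTorus 2 L))),
      Filter.Tendsto Ls Filter.atTop Filter.atTop →
      (∀ j, IsGroundStateInSector (hubbardTorusTT' (Ls j) 1 s (29 / 5)) (rectN 1 (Ls j)) 0 (ψ (Ls j))) →
      (∀ j, star (ψ (Ls j)) ⬝ᵥ ψ (Ls j) = 1) → ω.IsTorusLimitOf ψ Ls →
      valI s ≤ ((Finset.univ : Finset (DihedralGroup 4)).card : ℝ)⁻¹ * ∑ g ∈ (Finset.univ : Finset (DihedralGroup 4)),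
        (ω.expect (d4ShiftSet g 0 (Literature.Probability.LatticeModels.box 2 7))
          (fermionEmbed (PolySite.d4Emb g 0 (Literature.Probability.LatticeModels.box 2 7)) (-oddMomentObsTT s (29 / 5) 0))).re)
    (hcI : ∀ s ∈ Set.Icc (-3 / 10 : ℝ) (-1 / 5), -valI s ≤ ((c : ℚ) : ℝ))
    (hO : ∀ s ∈ Set.Icc (-3 / 10 * (2 - 29 / 5 / UL) : ℝ) (-3 / 10),
      ∀ (ω : InfVolFermionState 2) (Ls : ℕ → ℕ) (ψ : ∀ L, Fock (Orb (FermionTorus 2 L))),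
      Filter.Tendsto Ls Filter.atTop Filter.atTop →
      (∀ j, IsGroundStateInSector (hubbardTorusTT' (Ls j) 1 s (29 / 5)) (rectN 1 (Ls j)) 0 (ψ (Ls j))) →
      (∀ j, star (ψ (Ls j)) ⬝ᵥ ψ (Ls j) = 1) → ω.IsTorusLimitOf ψ Ls →
      valO s ≤ ((Finset.univ : Finset (DihedralGroup 4)).card : ℝ)⁻¹ * ∑ g ∈ (Finset.univ : Finset (DihedralGroup 4)),
        (ω.expect (d4ShiftSet g 0 (Literature.Probability.LatticeModels.box 2 7))
          (fermionEmbed (PolySite.d4Emb g 0 (Literature.Probability.LatticeModels.box 2 7)) (-oddMomentObsTT (-3 / 10) (29 / 5) 0))).re)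
    (hcO : ∀ s ∈ Set.Icc (-3 / 10 * (2 - 29 / 5 / UL) : ℝ) (-3 / 10), -valO s ≤ ((c : ℚ) : ℝ))
    (hL : ∀ U' ∈ Set.Icc UL (74 / 5),
      ∀ (ω : InfVolFermionState 2) (Ls : ℕ → ℕ) (ψ : ∀ L, Fock (Orb (FermionTorus 2 L))),
      Filter.Tendsto Ls Filter.atTop Filter.atTop →
      (∀ j, IsGroundStateInSector (hubbardTorusTT' (Ls j) 1 (-3 / 10) U') (rectN 1 (Ls j)) 0 (ψ (Ls j))) →
      (∀ j, star (ψ (Ls j)) ⬝ᵥ ψ (Ls j) = 1) → ω.IsTorusLimitOf ψ Ls →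
      valL U' ≤ ((Finset.univ : Finset (DihedralGroup 4)).card : ℝ)⁻¹ * ∑ g ∈ (Finset.univ : Finset (DihedralGroup 4)),
        (ω.expect (d4ShiftSet g 0 (Literature.Probability.LatticeModels.box 2 7))
          (fermionEmbed (PolySite.d4Emb g 0 (Literature.Probability.LatticeModels.box 2 7)) (-oddMomentObsTT (-3 / 10) U' 0))).re)
    (hcL : ∀ U' ∈ Set.Icc UL (74 / 5), -valL U' ≤ ((c : ℚ) : ℝ)) :
    HoldsOn (fun p : OneBandCoord → ℝ => ObsStiffnessSeqCeilingAt (p .tpOverT) (p .UOverT) (p .filling) c) boxLa214E_M2b :=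
  boxLa214E_M2b_stiffnessWord_of_laBoxE_leaf
    (ObsStiffnessSeqCeilingAt_on_laBoxE_of_apexStation29o5_shortOverhang_and_leftEdgeTop UL hAL valI valO valL c hI hcI hO hcO hL hcL)

/-- **RUNG-LEAF discharger — (E6), any window height**: the same families with `c ≤ 0.4364687` give `La214M2b_StiffnessBoxCeiling`.
[cite: KomaTasaki1994, §1] [cite: ScalapinoWhiteZhang1993, §II] -/
theorem La214M2b_StiffnessBoxCeiling_of_apexStation29o5_shortOverhang_and_leftEdgeTop (UL : ℝ) (hAL : 29 / 5 ≤ UL)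
    (valI valO valL : ℝ → ℝ) (c : ℚ) (hbar : c ≤ 4364687 / 10000000)
    (hI : ∀ s ∈ Set.Icc (-3 / 10 : ℝ) (-1 / 5),
      ∀ (ω : InfVolFermionState 2) (Ls : ℕ → ℕ) (ψ : ∀ L, Fock (Orb (FermionTorus 2 L))),
      Filter.Tendsto Ls Filter.atTop Filter.atTop →
      (∀ j, IsGroundStateInSector (hubbardTorusTT' (Ls j) 1 s (29 / 5)) (rectN 1 (Ls j)) 0 (ψ (Ls j))) →
      (∀ j, star (ψ (Ls j)) ⬝ᵥ ψ (Ls j) = 1) → ω.IsTorusLimitOf ψ Ls →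
      valI s ≤ ((Finset.univ : Finset (DihedralGroup 4)).card : ℝ)⁻¹ * ∑ g ∈ (Finset.univ : Finset (DihedralGroup 4)),
        (ω.expect (d4ShiftSet g 0 (Literature.Probability.LatticeModels.box 2 7))
          (fermionEmbed (PolySite.d4Emb g 0 (Literature.Probability.LatticeModels.box 2 7)) (-oddMomentObsTT s (29 / 5) 0))).re)
    (hcI : ∀ s ∈ Set.Icc (-3 / 10 : ℝ) (-1 / 5), -valI s ≤ ((c : ℚ) : ℝ))
    (hO : ∀ s ∈ Set.Icc (-3 / 10 * (2 - 29 / 5 / UL) : ℝ) (-3 / 10),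
      ∀ (ω : InfVolFermionState 2) (Ls : ℕ → ℕ) (ψ : ∀ L, Fock (Orb (FermionTorus 2 L))),
      Filter.Tendsto Ls Filter.atTop Filter.atTop →
      (∀ j, IsGroundStateInSector (hubbardTorusTT' (Ls j) 1 s (29 / 5)) (rectN 1 (Ls j)) 0 (ψ (Ls j))) →
      (∀ j, star (ψ (Ls j)) ⬝ᵥ ψ (Ls j) = 1) → ω.IsTorusLimitOf ψ Ls →
      valO s ≤ ((Finset.univ : Finset (DihedralGroup 4)).card : ℝ)⁻¹ * ∑ g ∈ (Finset.univ : Finset (DihedralGroup 4)),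
        (ω.expect (d4ShiftSet g 0 (Literature.Probability.LatticeModels.box 2 7))
          (fermionEmbed (PolySite.d4Emb g 0 (Literature.Probability.LatticeModels.box 2 7)) (-oddMomentObsTT (-3 / 10) (29 / 5) 0))).re)
    (hcO : ∀ s ∈ Set.Icc (-3 / 10 * (2 - 29 / 5 / UL) : ℝ) (-3 / 10), -valO s ≤ ((c : ℚ) : ℝ))
    (hL : ∀ U' ∈ Set.Icc UL (74 / 5),
      ∀ (ω : InfVolFermionState 2) (Ls : ℕ → ℕ) (ψ : ∀ L, Fock (Orb (FermionTorus 2 L))),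
      Filter.Tendsto Ls Filter.atTop Filter.atTop →
      (∀ j, IsGroundStateInSector (hubbardTorusTT' (Ls j) 1 (-3 / 10) U') (rectN 1 (Ls j)) 0 (ψ (Ls j))) →
      (∀ j, star (ψ (Ls j)) ⬝ᵥ ψ (Ls j) = 1) → ω.IsTorusLimitOf ψ Ls →
      valL U' ≤ ((Finset.univ : Finset (DihedralGroup 4)).card : ℝ)⁻¹ * ∑ g ∈ (Finset.univ : Finset (DihedralGroup 4)),
        (ω.expect (d4ShiftSet g 0 (Literature.Probability.LatticeModels.box 2 7))
          (fermionEmbed (PolySite.d4Emb g 0 (Literature.Probability.LatticeModels.box 2 7)) (-oddMomentObsTT (-3 / 10) U' 0))).re)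
    (hcL : ∀ U' ∈ Set.Icc UL (74 / 5), -valL U' ≤ ((c : ℚ) : ℝ)) :
    La214M2b_StiffnessBoxCeiling :=
  La214M2b_StiffnessBoxCeiling_of_holdsOn hbar
    (boxLa214E_M2b_stiffnessWord_of_apexStation29o5_shortOverhang_and_leftEdgeTop UL hAL valI valO valL c hI hcI hO hcO hL hcL)

/-! ## §2 THE `U_L = 8` EDITION: overhang `[−153/400, −3/10] × {29/5}`, left-top `{−3/10} × [8, 74/5]` -/

/-- **M2(b) CLOSER — (E6) with `U_L = 8`, family form**: inner own-word family on `[−3/10, −1/5] × {29/5}`, corner-objective (`−X₀(−3/10)`) family on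
`[−153/400, −3/10] × {29/5}`, own-word family on `{−3/10} × [8, 74/5]`, all with `−val ≤ c` ⇒ the stiffness word `c` on `boxLa214E_M2b`.
[cite: KomaTasaki1994, §1] [cite: ScalapinoWhiteZhang1993, §II] -/
theorem boxLa214E_M2b_stiffnessWord_of_apexStation29o5_shortOverhang153o400_and_leftEdgeTop8 (valI valO valL : ℝ → ℝ) (c : ℚ)
    (hI : ∀ s ∈ Set.Icc (-3 / 10 : ℝ) (-1 / 5),
      ∀ (ω : InfVolFermionState 2) (Ls : ℕ → ℕ) (ψ : ∀ L, Fock (Orb (FermionTorus 2 L))),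
      Filter.Tendsto Ls Filter.atTop Filter.atTop →
      (∀ j, IsGroundStateInSector (hubbardTorusTT' (Ls j) 1 s (29 / 5)) (rectN 1 (Ls j)) 0 (ψ (Ls j))) →
      (∀ j, star (ψ (Ls j)) ⬝ᵥ ψ (Ls j) = 1) → ω.IsTorusLimitOf ψ Ls →
      valI s ≤ ((Finset.univ : Finset (DihedralGroup 4)).card : ℝ)⁻¹ * ∑ g ∈ (Finset.univ : Finset (DihedralGroup 4)),
        (ω.expect (d4ShiftSet g 0 (Literature.Probability.LatticeModels.box 2 7))
          (fermionEmbed (PolySite.d4Emb g 0 (Literature.Probability.LatticeModels.box 2 7)) (-oddMomentObsTT s (29 / 5) 0))).re)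
    (hcI : ∀ s ∈ Set.Icc (-3 / 10 : ℝ) (-1 / 5), -valI s ≤ ((c : ℚ) : ℝ))
    (hO : ∀ s ∈ Set.Icc (-(153 / 400) : ℝ) (-3 / 10),
      ∀ (ω : InfVolFermionState 2) (Ls : ℕ → ℕ) (ψ : ∀ L, Fock (Orb (FermionTorus 2 L))),
      Filter.Tendsto Ls Filter.atTop Filter.atTop →
      (∀ j, IsGroundStateInSector (hubbardTorusTT' (Ls j) 1 s (29 / 5)) (rectN 1 (Ls j)) 0 (ψ (Ls j))) →
      (∀ j, star (ψ (Ls j)) ⬝ᵥ ψ (Ls j) = 1) → ω.IsTorusLimitOf ψ Ls →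
      valO s ≤ ((Finset.univ : Finset (DihedralGroup 4)).card : ℝ)⁻¹ * ∑ g ∈ (Finset.univ : Finset (DihedralGroup 4)),
        (ω.expect (d4ShiftSet g 0 (Literature.Probability.LatticeModels.box 2 7))
          (fermionEmbed (PolySite.d4Emb g 0 (Literature.Probability.LatticeModels.box 2 7)) (-oddMomentObsTT (-3 / 10) (29 / 5) 0))).re)
    (hcO : ∀ s ∈ Set.Icc (-(153 / 400) : ℝ) (-3 / 10), -valO s ≤ ((c : ℚ) : ℝ))
    (hL : ∀ U' ∈ Set.Icc (8 : ℝ) (74 / 5),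
      ∀ (ω : InfVolFermionState 2) (Ls : ℕ → ℕ) (ψ : ∀ L, Fock (Orb (FermionTorus 2 L))),
      Filter.Tendsto Ls Filter.atTop Filter.atTop →
      (∀ j, IsGroundStateInSector (hubbardTorusTT' (Ls j) 1 (-3 / 10) U') (rectN 1 (Ls j)) 0 (ψ (Ls j))) →
      (∀ j, star (ψ (Ls j)) ⬝ᵥ ψ (Ls j) = 1) → ω.IsTorusLimitOf ψ Ls →
      valL U' ≤ ((Finset.univ : Finset (DihedralGroup 4)).card : ℝ)⁻¹ * ∑ g ∈ (Finset.univ : Finset (DihedralGroup 4)),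
        (ω.expect (d4ShiftSet g 0 (Literature.Probability.LatticeModels.box 2 7))
          (fermionEmbed (PolySite.d4Emb g 0 (Literature.Probability.LatticeModels.box 2 7)) (-oddMomentObsTT (-3 / 10) U' 0))).re)
    (hcL : ∀ U' ∈ Set.Icc (8 : ℝ) (74 / 5), -valL U' ≤ ((c : ℚ) : ℝ)) :
    HoldsOn (fun p : OneBandCoord → ℝ => ObsStiffnessSeqCeilingAt (p .tpOverT) (p .UOverT) (p .filling) c) boxLa214E_M2b :=
  boxLa214E_M2b_stiffnessWord_of_laBoxE_leaf
    (ObsStiffnessSeqCeilingAt_on_laBoxE_of_apexStation29o5_shortOverhang153o400_and_leftEdgeTop8 valI valO valL c hI hcI hO hcO hL hcL)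

/-- **M2(b) CLOSER — (E6) with `U_L = 8` FROM THREE BOXDUAL BUNDLES, six vertex constants.** INNER bundle on `[−3/10, −1/5] × {29/5}`: the chord of the
own-word vertex constants `vI₁` (at `−3/10`) and `vI₂` (at `−1/5`); SHORT OVERHANG bundle on `[−153/400, −3/10] × {29/5}`: the chord of `vO₁` (at `−153/400`)
and `vO₂` (at `−3/10`) for the CONSTANT objective `−X₀(−3/10)` (`-oddMomentObsTT (-3/10) (29/5) 0` at every `s`; the `(29/5; −3/10)` own-word certificate IS
the `vO₂` certificate); LEFT-TOP bundle on `{−3/10} × [8, 74/5]`: the chord IN `U` of the own-word vertex constants `vL₁` (at `(8; −3/10)`) and `vL₂` (at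
`(74/5; −3/10)`); `c ≥ −vI₁, −vI₂, −vO₁, −vO₂, −vL₁, −vL₂`. Then the stiffness word `c` holds on `boxLa214E_M2b`.
[cite: KomaTasaki1994, §1] [cite: ScalapinoWhiteZhang1993, §II] -/
theorem boxLa214E_M2b_stiffnessWord_of_apexStation29o5_innerChord_shortOverhangChord153o400_and_leftEdgeTop8Chord
    (vI₁ vI₂ vO₁ vO₂ vL₁ vL₂ : ℝ) (c : ℚ)
    (hcI₁ : -vI₁ ≤ ((c : ℚ) : ℝ)) (hcI₂ : -vI₂ ≤ ((c : ℚ) : ℝ)) (hcO₁ : -vO₁ ≤ ((c : ℚ) : ℝ)) (hcO₂ : -vO₂ ≤ ((c : ℚ) : ℝ))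
    (hcL₁ : -vL₁ ≤ ((c : ℚ) : ℝ)) (hcL₂ : -vL₂ ≤ ((c : ℚ) : ℝ))
    (hInner : ∀ s ∈ Set.Icc (-3 / 10 : ℝ) (-1 / 5),
      ∀ (ω : InfVolFermionState 2) (Ls : ℕ → ℕ) (ψ : ∀ L, Fock (Orb (FermionTorus 2 L))),
      Filter.Tendsto Ls Filter.atTop Filter.atTop →
      (∀ j, IsGroundStateInSector (hubbardTorusTT' (Ls j) 1 s (29 / 5)) (rectN 1 (Ls j)) 0 (ψ (Ls j))) →
      (∀ j, star (ψ (Ls j)) ⬝ᵥ ψ (Ls j) = 1) → ω.IsTorusLimitOf ψ Ls →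
      (-1 / 5 - s) / (-1 / 5 - -3 / 10) * vI₁ + (s - -3 / 10) / (-1 / 5 - -3 / 10) * vI₂ ≤
        ((Finset.univ : Finset (DihedralGroup 4)).card : ℝ)⁻¹ * ∑ g ∈ (Finset.univ : Finset (DihedralGroup 4)),
          (ω.expect (d4ShiftSet g 0 (Literature.Probability.LatticeModels.box 2 7))
            (fermionEmbed (PolySite.d4Emb g 0 (Literature.Probability.LatticeModels.box 2 7)) (-oddMomentObsTT s (29 / 5) 0))).re)
    (hOverhang : ∀ s ∈ Set.Icc (-(153 / 400) : ℝ) (-3 / 10),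
      ∀ (ω : InfVolFermionState 2) (Ls : ℕ → ℕ) (ψ : ∀ L, Fock (Orb (FermionTorus 2 L))),
      Filter.Tendsto Ls Filter.atTop Filter.atTop →
      (∀ j, IsGroundStateInSector (hubbardTorusTT' (Ls j) 1 s (29 / 5)) (rectN 1 (Ls j)) 0 (ψ (Ls j))) →
      (∀ j, star (ψ (Ls j)) ⬝ᵥ ψ (Ls j) = 1) → ω.IsTorusLimitOf ψ Ls →
      (-3 / 10 - s) / (-3 / 10 - -(153 / 400)) * vO₁ + (s - -(153 / 400)) / (-3 / 10 - -(153 / 400)) * vO₂ ≤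
        ((Finset.univ : Finset (DihedralGroup 4)).card : ℝ)⁻¹ * ∑ g ∈ (Finset.univ : Finset (DihedralGroup 4)),
          (ω.expect (d4ShiftSet g 0 (Literature.Probability.LatticeModels.box 2 7))
            (fermionEmbed (PolySite.d4Emb g 0 (Literature.Probability.LatticeModels.box 2 7)) (-oddMomentObsTT (-3 / 10) (29 / 5) 0))).re)
    (hLeftTop : ∀ U' ∈ Set.Icc (8 : ℝ) (74 / 5),
      ∀ (ω : InfVolFermionState 2) (Ls : ℕ → ℕ) (ψ : ∀ L, Fock (Orb (FermionTorus 2 L))),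
      Filter.Tendsto Ls Filter.atTop Filter.atTop →
      (∀ j, IsGroundStateInSector (hubbardTorusTT' (Ls j) 1 (-3 / 10) U') (rectN 1 (Ls j)) 0 (ψ (Ls j))) →
      (∀ j, star (ψ (Ls j)) ⬝ᵥ ψ (Ls j) = 1) → ω.IsTorusLimitOf ψ Ls →
      (74 / 5 - U') / (74 / 5 - 8) * vL₁ + (U' - 8) / (74 / 5 - 8) * vL₂ ≤
        ((Finset.univ : Finset (DihedralGroup 4)).card : ℝ)⁻¹ * ∑ g ∈ (Finset.univ : Finset (DihedralGroup 4)),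
          (ω.expect (d4ShiftSet g 0 (Literature.Probability.LatticeModels.box 2 7))
            (fermionEmbed (PolySite.d4Emb g 0 (Literature.Probability.LatticeModels.box 2 7)) (-oddMomentObsTT (-3 / 10) U' 0))).re) :
    HoldsOn (fun p : OneBandCoord → ℝ => ObsStiffnessSeqCeilingAt (p .tpOverT) (p .UOverT) (p .filling) c) boxLa214E_M2b :=
  boxLa214E_M2b_stiffnessWord_of_laBoxE_leaf
    (ObsStiffnessSeqCeilingAt_on_laBoxE_of_apexStation29o5_innerChord_shortOverhangChord153o400_and_leftEdgeTop8Chord vI₁ vI₂ vO₁ vO₂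
      vL₁ vL₂ c hcI₁ hcI₂ hcO₁ hcO₂ hcL₁ hcL₂ hInner hOverhang hLeftTop)

/-- **RUNG LEAF from the THREE BUNDLES of (E6), `U_L = 8`** (inner own-word chord `vI₁, vI₂`; short-overhang chord `vO₁, vO₂` for `−X₀(−3/10)`; left-top chord
in `U` `vL₁, vL₂`), `c ≥` the six negated constants, `c ≤ 0.4364687` ⇒ `La214M2b_StiffnessBoxCeiling`. [cite: KomaTasaki1994, §1] [cite: ScalapinoWhiteZhang1993, §II] -/
theorem La214M2b_StiffnessBoxCeiling_of_apexStation29o5_leftEdgeTop8_threeBundles (vI₁ vI₂ vO₁ vO₂ vL₁ vL₂ : ℝ) (c : ℚ)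
    (hbar : c ≤ 4364687 / 10000000)
    (hcI₁ : -vI₁ ≤ ((c : ℚ) : ℝ)) (hcI₂ : -vI₂ ≤ ((c : ℚ) : ℝ)) (hcO₁ : -vO₁ ≤ ((c : ℚ) : ℝ)) (hcO₂ : -vO₂ ≤ ((c : ℚ) : ℝ))
    (hcL₁ : -vL₁ ≤ ((c : ℚ) : ℝ)) (hcL₂ : -vL₂ ≤ ((c : ℚ) : ℝ))
    (hInner : ∀ s ∈ Set.Icc (-3 / 10 : ℝ) (-1 / 5),
      ∀ (ω : InfVolFermionState 2) (Ls : ℕ → ℕ) (ψ : ∀ L, Fock (Orb (FermionTorus 2 L))),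
      Filter.Tendsto Ls Filter.atTop Filter.atTop →
      (∀ j, IsGroundStateInSector (hubbardTorusTT' (Ls j) 1 s (29 / 5)) (rectN 1 (Ls j)) 0 (ψ (Ls j))) →
      (∀ j, star (ψ (Ls j)) ⬝ᵥ ψ (Ls j) = 1) → ω.IsTorusLimitOf ψ Ls →
      (-1 / 5 - s) / (-1 / 5 - -3 / 10) * vI₁ + (s - -3 / 10) / (-1 / 5 - -3 / 10) * vI₂ ≤
        ((Finset.univ : Finset (DihedralGroup 4)).card : ℝ)⁻¹ * ∑ g ∈ (Finset.univ : Finset (DihedralGroup 4)),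
          (ω.expect (d4ShiftSet g 0 (Literature.Probability.LatticeModels.box 2 7))
            (fermionEmbed (PolySite.d4Emb g 0 (Literature.Probability.LatticeModels.box 2 7)) (-oddMomentObsTT s (29 / 5) 0))).re)
    (hOverhang : ∀ s ∈ Set.Icc (-(153 / 400) : ℝ) (-3 / 10),
      ∀ (ω : InfVolFermionState 2) (Ls : ℕ → ℕ) (ψ : ∀ L, Fock (Orb (FermionTorus 2 L))),
      Filter.Tendsto Ls Filter.atTop Filter.atTop →
      (∀ j, IsGroundStateInSector (hubbardTorusTT' (Ls j) 1 s (29 / 5)) (rectN 1 (Ls j)) 0 (ψ (Ls j))) →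
      (∀ j, star (ψ (Ls j)) ⬝ᵥ ψ (Ls j) = 1) → ω.IsTorusLimitOf ψ Ls →
      (-3 / 10 - s) / (-3 / 10 - -(153 / 400)) * vO₁ + (s - -(153 / 400)) / (-3 / 10 - -(153 / 400)) * vO₂ ≤
        ((Finset.univ : Finset (DihedralGroup 4)).card : ℝ)⁻¹ * ∑ g ∈ (Finset.univ : Finset (DihedralGroup 4)),
          (ω.expect (d4ShiftSet g 0 (Literature.Probability.LatticeModels.box 2 7))
            (fermionEmbed (PolySite.d4Emb g 0 (Literature.Probability.LatticeModels.box 2 7)) (-oddMomentObsTT (-3 / 10) (29 / 5) 0))).re)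
    (hLeftTop : ∀ U' ∈ Set.Icc (8 : ℝ) (74 / 5),
      ∀ (ω : InfVolFermionState 2) (Ls : ℕ → ℕ) (ψ : ∀ L, Fock (Orb (FermionTorus 2 L))),
      Filter.Tendsto Ls Filter.atTop Filter.atTop →
      (∀ j, IsGroundStateInSector (hubbardTorusTT' (Ls j) 1 (-3 / 10) U') (rectN 1 (Ls j)) 0 (ψ (Ls j))) →
      (∀ j, star (ψ (Ls j)) ⬝ᵥ ψ (Ls j) = 1) → ω.IsTorusLimitOf ψ Ls →
      (74 / 5 - U') / (74 / 5 - 8) * vL₁ + (U' - 8) / (74 / 5 - 8) * vL₂ ≤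
        ((Finset.univ : Finset (DihedralGroup 4)).card : ℝ)⁻¹ * ∑ g ∈ (Finset.univ : Finset (DihedralGroup 4)),
          (ω.expect (d4ShiftSet g 0 (Literature.Probability.LatticeModels.box 2 7))
            (fermionEmbed (PolySite.d4Emb g 0 (Literature.Probability.LatticeModels.box 2 7)) (-oddMomentObsTT (-3 / 10) U' 0))).re) :
    La214M2b_StiffnessBoxCeiling :=
  La214M2b_StiffnessBoxCeiling_of_holdsOn hbar
    (boxLa214E_M2b_stiffnessWord_of_apexStation29o5_innerChord_shortOverhangChord153o400_and_leftEdgeTop8Chord vI₁ vI₂ vO₁ vO₂ vL₁ vL₂ c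
      hcI₁ hcI₂ hcO₁ hcO₂ hcL₁ hcL₂ hInner hOverhang hLeftTop)


/-! ## §3 (E6) `U_L = 8` ON THE BUNDLES OF RECORD: the (E1) outer bundle `[−357/740, −3/10]` read on the short overhang — the far vertex may overshoot -/

/-- **An affine family on `[a, b]` read on a right sub-segment `[m, b]` is at least the smaller of its values at `m` and at `b`.** `a < b`, `m ≤ s ≤ b`:
`min (chord m) v₂ ≤ chord s` with `chord s = (b − s)/(b − a)·v₁ + (s − a)/(b − a)·v₂` (`chord b = v₂`). [folklore] -/
theorem chord_min_le_on_rightSubsegment {a b m s v₁ v₂ : ℝ} (hab : a < b) (hms : m ≤ s) (hsb : s ≤ b) :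
    min ((b - m) / (b - a) * v₁ + (m - a) / (b - a) * v₂) v₂ ≤ (b - s) / (b - a) * v₁ + (s - a) / (b - a) * v₂ := by
  have hd : 0 < b - a := sub_pos.2 hab
  have hne : b - a ≠ 0 := hd.ne'
  have e1 : (b - s) / (b - a) * v₁ + (s - a) / (b - a) * v₂ -
      ((b - m) / (b - a) * v₁ + (m - a) / (b - a) * v₂) = (s - m) / (b - a) * (v₂ - v₁) := by
    field_simp
    ring
  have e2 : (b - s) / (b - a) * v₁ + (s - a) / (b - a) * v₂ - v₂ = (b - s) / (b - a) * (v₁ - v₂) := by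
    field_simp
    ring
  rcases le_total v₁ v₂ with h | h
  · have h0 : 0 ≤ (s - m) / (b - a) * (v₂ - v₁) := mul_nonneg (div_nonneg (by linarith) hd.le) (by linarith)
    calc min ((b - m) / (b - a) * v₁ + (m - a) / (b - a) * v₂) v₂
        ≤ (b - m) / (b - a) * v₁ + (m - a) / (b - a) * v₂ := min_le_left _ _
      _ ≤ (b - s) / (b - a) * v₁ + (s - a) / (b - a) * v₂ := by linarith [e1]
  · have h0 : 0 ≤ (b - s) / (b - a) * (v₁ - v₂) := mul_nonneg (div_nonneg (by linarith) hd.le) (by linarith)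
    calc min ((b - m) / (b - a) * v₁ + (m - a) / (b - a) * v₂) v₂ ≤ v₂ := min_le_right _ _
      _ ≤ (b - s) / (b - a) * v₁ + (s - a) / (b - a) * v₂ := by linarith [e2]

/-- **The weights of the (E1) outer chord of «La214-E» (`[−357/740, −3/10]`) at the (E6) short-overhang end `−153/400`**: `407/900` on the far vertex
`−357/740`, `493/900` on the corner `−3/10` (`33/400 ÷ 27/148` and its complement). [folklore] -/
theorem la214E_outerChord_weights_at_153o400 :
    (-3 / 10 - -(153 / 400) : ℝ) / (-3 / 10 - -(357 / 740)) = 407 / 900 ∧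
      (-(153 / 400) - -(357 / 740) : ℝ) / (-3 / 10 - -(357 / 740)) = 493 / 900 := by
  constructor <;> norm_num

/-- **M2(b) CLOSER — (E6) `U_L = 8` ON THE TWO D2-A BUNDLES OF RECORD plus the LEFT-TOP bundle: the far vertex may overshoot the bar.** The INNER bundle
on `[−3/10, −1/5] × {29/5}` (own-word chord `vI₁, vI₂`) and the (E1) OUTER bundle EXACTLY AS BOOKED (chord of `vO₁` at `−357/740` and `vO₂` at `−3/10` for the
objective `−X₀(−3/10)` on the WHOLE overhang `[−357/740, −3/10] × {29/5}` — the `hOuter` hypothesis of `La214M2b_StiffnessBoxCeiling_of_apexStation29o5_twoBundles`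
verbatim), plus the left-top chord in `U` on `{−3/10} × [8, 74/5]` (`vL₁` at `U = 8`, `vL₂` at `U = 74/5`). Conditions: `c ≥ −vI₁, −vI₂, −vO₂, −vL₁, −vL₂` and,
IN PLACE OF `c ≥ −vO₁`, only `c ≥ −(407/900·vO₁ + 493/900·vO₂)` — the outer chord read at `−153/400`, beyond which (E6) does not use it: the far-vertex
constant may fall below `−c` by up to `493/407 ≈ 1.21` times the corner's margin `vO₂ + c`. Then the stiffness word `c` holds on `boxLa214E_M2b`.
[cite: KomaTasaki1994, §1] [cite: ScalapinoWhiteZhang1993, §II] -/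
theorem boxLa214E_M2b_stiffnessWord_of_apexStation29o5_twoBundlesOfRecord_and_leftEdgeTop8Chord (vI₁ vI₂ vO₁ vO₂ vL₁ vL₂ : ℝ) (c : ℚ)
    (hcI₁ : -vI₁ ≤ ((c : ℚ) : ℝ)) (hcI₂ : -vI₂ ≤ ((c : ℚ) : ℝ)) (hcOm : -(407 / 900 * vO₁ + 493 / 900 * vO₂) ≤ ((c : ℚ) : ℝ))
    (hcO₂ : -vO₂ ≤ ((c : ℚ) : ℝ)) (hcL₁ : -vL₁ ≤ ((c : ℚ) : ℝ)) (hcL₂ : -vL₂ ≤ ((c : ℚ) : ℝ))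
    (hInner : ∀ s ∈ Set.Icc (-3 / 10 : ℝ) (-1 / 5),
      ∀ (ω : InfVolFermionState 2) (Ls : ℕ → ℕ) (ψ : ∀ L, Fock (Orb (FermionTorus 2 L))),
      Filter.Tendsto Ls Filter.atTop Filter.atTop →
      (∀ j, IsGroundStateInSector (hubbardTorusTT' (Ls j) 1 s (29 / 5)) (rectN 1 (Ls j)) 0 (ψ (Ls j))) →
      (∀ j, star (ψ (Ls j)) ⬝ᵥ ψ (Ls j) = 1) → ω.IsTorusLimitOf ψ Ls →
      (-1 / 5 - s) / (-1 / 5 - -3 / 10) * vI₁ + (s - -3 / 10) / (-1 / 5 - -3 / 10) * vI₂ ≤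
        ((Finset.univ : Finset (DihedralGroup 4)).card : ℝ)⁻¹ * ∑ g ∈ (Finset.univ : Finset (DihedralGroup 4)),
          (ω.expect (d4ShiftSet g 0 (Literature.Probability.LatticeModels.box 2 7))
            (fermionEmbed (PolySite.d4Emb g 0 (Literature.Probability.LatticeModels.box 2 7)) (-oddMomentObsTT s (29 / 5) 0))).re)
    (hOuter : ∀ s ∈ Set.Icc (-(357 / 740) : ℝ) (-3 / 10),
      ∀ (ω : InfVolFermionState 2) (Ls : ℕ → ℕ) (ψ : ∀ L, Fock (Orb (FermionTorus 2 L))),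
      Filter.Tendsto Ls Filter.atTop Filter.atTop →
      (∀ j, IsGroundStateInSector (hubbardTorusTT' (Ls j) 1 s (29 / 5)) (rectN 1 (Ls j)) 0 (ψ (Ls j))) →
      (∀ j, star (ψ (Ls j)) ⬝ᵥ ψ (Ls j) = 1) → ω.IsTorusLimitOf ψ Ls →
      (-3 / 10 - s) / (-3 / 10 - -(357 / 740)) * vO₁ + (s - -(357 / 740)) / (-3 / 10 - -(357 / 740)) * vO₂ ≤
        ((Finset.univ : Finset (DihedralGroup 4)).card : ℝ)⁻¹ * ∑ g ∈ (Finset.univ : Finset (DihedralGroup 4)),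
          (ω.expect (d4ShiftSet g 0 (Literature.Probability.LatticeModels.box 2 7))
            (fermionEmbed (PolySite.d4Emb g 0 (Literature.Probability.LatticeModels.box 2 7)) (-oddMomentObsTT (-3 / 10) (29 / 5) 0))).re)
    (hLeftTop : ∀ U' ∈ Set.Icc (8 : ℝ) (74 / 5),
      ∀ (ω : InfVolFermionState 2) (Ls : ℕ → ℕ) (ψ : ∀ L, Fock (Orb (FermionTorus 2 L))),
      Filter.Tendsto Ls Filter.atTop Filter.atTop →
      (∀ j, IsGroundStateInSector (hubbardTorusTT' (Ls j) 1 (-3 / 10) U') (rectN 1 (Ls j)) 0 (ψ (Ls j))) →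
      (∀ j, star (ψ (Ls j)) ⬝ᵥ ψ (Ls j) = 1) → ω.IsTorusLimitOf ψ Ls →
      (74 / 5 - U') / (74 / 5 - 8) * vL₁ + (U' - 8) / (74 / 5 - 8) * vL₂ ≤
        ((Finset.univ : Finset (DihedralGroup 4)).card : ℝ)⁻¹ * ∑ g ∈ (Finset.univ : Finset (DihedralGroup 4)),
          (ω.expect (d4ShiftSet g 0 (Literature.Probability.LatticeModels.box 2 7))
            (fermionEmbed (PolySite.d4Emb g 0 (Literature.Probability.LatticeModels.box 2 7)) (-oddMomentObsTT (-3 / 10) U' 0))).re) :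
    HoldsOn (fun p : OneBandCoord → ℝ => ObsStiffnessSeqCeilingAt (p .tpOverT) (p .UOverT) (p .filling) c) boxLa214E_M2b := by
  refine boxLa214E_M2b_stiffnessWord_of_apexStation29o5_shortOverhang153o400_and_leftEdgeTop8
    (fun s => (-1 / 5 - s) / (-1 / 5 - -3 / 10) * vI₁ + (s - -3 / 10) / (-1 / 5 - -3 / 10) * vI₂)
    (fun s => (-3 / 10 - s) / (-3 / 10 - -(357 / 740)) * vO₁ + (s - -(357 / 740)) / (-3 / 10 - -(357 / 740)) * vO₂)
    (fun U' => (74 / 5 - U') / (74 / 5 - 8) * vL₁ + (U' - 8) / (74 / 5 - 8) * vL₂) c hInner (fun s hs => ?_)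
    (fun s hs => hOuter s ⟨le_trans (by norm_num) hs.1, hs.2⟩) (fun s hs => ?_) hLeftTop (fun U' hU' => ?_)
  · obtain ⟨hl₁, hl₂, hsum, -, -⟩ := tPrimeSegment_weights (by norm_num : (-3 / 10 : ℝ) < -1 / 5) hs.1 hs.2
    have hmin := min_le_chord_of_weights (c₁ := vI₁) (c₂ := vI₂) hl₁ hl₂ hsum
    have hneg : -min vI₁ vI₂ ≤ ((c : ℚ) : ℝ) := by
      rcases le_total vI₁ vI₂ with hv | hv
      · rw [min_eq_left hv]; exact hcI₁
      · rw [min_eq_right hv]; exact hcI₂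
    linarith
  · -- the booked outer chord read on `[−153/400, −3/10]`: at least `min (chord(−153/400)) vO₂`
    have hmin := chord_min_le_on_rightSubsegment (a := -(357 / 740)) (b := -3 / 10) (m := -(153 / 400)) (v₁ := vO₁) (v₂ := vO₂)
      (by norm_num) hs.1 hs.2
    obtain ⟨e1, e2⟩ := la214E_outerChord_weights_at_153o400
    rw [e1, e2] at hmin
    have hneg : -min (407 / 900 * vO₁ + 493 / 900 * vO₂) vO₂ ≤ ((c : ℚ) : ℝ) := by
      rcases le_total (407 / 900 * vO₁ + 493 / 900 * vO₂) vO₂ with hv | hv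
      · rw [min_eq_left hv]; exact hcOm
      · rw [min_eq_right hv]; exact hcO₂
    linarith
  · obtain ⟨hl₁, hl₂, hsum, -, -⟩ := tPrimeSegment_weights (by norm_num : (8 : ℝ) < 74 / 5) hU'.1 hU'.2
    have hmin := min_le_chord_of_weights (c₁ := vL₁) (c₂ := vL₂) hl₁ hl₂ hsum
    have hneg : -min vL₁ vL₂ ≤ ((c : ℚ) : ℝ) := by
      rcases le_total vL₁ vL₂ with hv | hv
      · rw [min_eq_left hv]; exact hcL₁
      · rw [min_eq_right hv]; exact hcL₂
    linarith

/-- **RUNG LEAF from the TWO D2-A BUNDLES OF RECORD + the LEFT-TOP bundle (`U_L = 8`)**, far-vertex condition relaxed to the chord value at `−153/400`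
(`c ≥ −(407/900·vO₁ + 493/900·vO₂)`), `c ≤ 0.4364687` ⇒ `La214M2b_StiffnessBoxCeiling`. [cite: KomaTasaki1994, §1] [cite: ScalapinoWhiteZhang1993, §II] -/
theorem La214M2b_StiffnessBoxCeiling_of_apexStation29o5_twoBundlesOfRecord_and_leftEdgeTop8 (vI₁ vI₂ vO₁ vO₂ vL₁ vL₂ : ℝ) (c : ℚ)
    (hbar : c ≤ 4364687 / 10000000)
    (hcI₁ : -vI₁ ≤ ((c : ℚ) : ℝ)) (hcI₂ : -vI₂ ≤ ((c : ℚ) : ℝ)) (hcOm : -(407 / 900 * vO₁ + 493 / 900 * vO₂) ≤ ((c : ℚ) : ℝ))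
    (hcO₂ : -vO₂ ≤ ((c : ℚ) : ℝ)) (hcL₁ : -vL₁ ≤ ((c : ℚ) : ℝ)) (hcL₂ : -vL₂ ≤ ((c : ℚ) : ℝ))
    (hInner : ∀ s ∈ Set.Icc (-3 / 10 : ℝ) (-1 / 5),
      ∀ (ω : InfVolFermionState 2) (Ls : ℕ → ℕ) (ψ : ∀ L, Fock (Orb (FermionTorus 2 L))),
      Filter.Tendsto Ls Filter.atTop Filter.atTop →
      (∀ j, IsGroundStateInSector (hubbardTorusTT' (Ls j) 1 s (29 / 5)) (rectN 1 (Ls j)) 0 (ψ (Ls j))) →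
      (∀ j, star (ψ (Ls j)) ⬝ᵥ ψ (Ls j) = 1) → ω.IsTorusLimitOf ψ Ls →
      (-1 / 5 - s) / (-1 / 5 - -3 / 10) * vI₁ + (s - -3 / 10) / (-1 / 5 - -3 / 10) * vI₂ ≤
        ((Finset.univ : Finset (DihedralGroup 4)).card : ℝ)⁻¹ * ∑ g ∈ (Finset.univ : Finset (DihedralGroup 4)),
          (ω.expect (d4ShiftSet g 0 (Literature.Probability.LatticeModels.box 2 7))
            (fermionEmbed (PolySite.d4Emb g 0 (Literature.Probability.LatticeModels.box 2 7)) (-oddMomentObsTT s (29 / 5) 0))).re)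
    (hOuter : ∀ s ∈ Set.Icc (-(357 / 740) : ℝ) (-3 / 10),
      ∀ (ω : InfVolFermionState 2) (Ls : ℕ → ℕ) (ψ : ∀ L, Fock (Orb (FermionTorus 2 L))),
      Filter.Tendsto Ls Filter.atTop Filter.atTop →
      (∀ j, IsGroundStateInSector (hubbardTorusTT' (Ls j) 1 s (29 / 5)) (rectN 1 (Ls j)) 0 (ψ (Ls j))) →
      (∀ j, star (ψ (Ls j)) ⬝ᵥ ψ (Ls j) = 1) → ω.IsTorusLimitOf ψ Ls →
      (-3 / 10 - s) / (-3 / 10 - -(357 / 740)) * vO₁ + (s - -(357 / 740)) / (-3 / 10 - -(357 / 740)) * vO₂ ≤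
        ((Finset.univ : Finset (DihedralGroup 4)).card : ℝ)⁻¹ * ∑ g ∈ (Finset.univ : Finset (DihedralGroup 4)),
          (ω.expect (d4ShiftSet g 0 (Literature.Probability.LatticeModels.box 2 7))
            (fermionEmbed (PolySite.d4Emb g 0 (Literature.Probability.LatticeModels.box 2 7)) (-oddMomentObsTT (-3 / 10) (29 / 5) 0))).re)
    (hLeftTop : ∀ U' ∈ Set.Icc (8 : ℝ) (74 / 5),
      ∀ (ω : InfVolFermionState 2) (Ls : ℕ → ℕ) (ψ : ∀ L, Fock (Orb (FermionTorus 2 L))),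
      Filter.Tendsto Ls Filter.atTop Filter.atTop →
      (∀ j, IsGroundStateInSector (hubbardTorusTT' (Ls j) 1 (-3 / 10) U') (rectN 1 (Ls j)) 0 (ψ (Ls j))) →
      (∀ j, star (ψ (Ls j)) ⬝ᵥ ψ (Ls j) = 1) → ω.IsTorusLimitOf ψ Ls →
      (74 / 5 - U') / (74 / 5 - 8) * vL₁ + (U' - 8) / (74 / 5 - 8) * vL₂ ≤
        ((Finset.univ : Finset (DihedralGroup 4)).card : ℝ)⁻¹ * ∑ g ∈ (Finset.univ : Finset (DihedralGroup 4)),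
          (ω.expect (d4ShiftSet g 0 (Literature.Probability.LatticeModels.box 2 7))
            (fermionEmbed (PolySite.d4Emb g 0 (Literature.Probability.LatticeModels.box 2 7)) (-oddMomentObsTT (-3 / 10) U' 0))).re) :
    La214M2b_StiffnessBoxCeiling :=
  La214M2b_StiffnessBoxCeiling_of_holdsOn hbar
    (boxLa214E_M2b_stiffnessWord_of_apexStation29o5_twoBundlesOfRecord_and_leftEdgeTop8Chord vI₁ vI₂ vO₁ vO₂ vL₁ vL₂ c hcI₁ hcI₂ hcOm hcO₂
      hcL₁ hcL₂ hInner hOuter hLeftTop)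

end Summit.Ventures.CertifiedManyBodySolver.Downfold

end
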